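import Literature.NumberTheory.GaloisRepresentations.SerreCartanNormalizerGL2Fp
import Summits.BirchSwinnertonDyer.BirchSwinnertonDyer.Theorems.SignedLowerHalvesSmallImageLowerHalfBothSignsRttInducedOfIndexTwo
import Literature.NumberTheory.EllipticCurves.GaloisAction
import Literature.NumberTheory.GaloisRepresentations.ArtinFormalismInductionProofs
import HarnessLib

/-!
# Route `SignedLowerHalves`, crux L `SmallImageLowerHalfBothSigns` (stmt-BirchSwinnertonDyer-23599), line `rtt_w3` v7 — brick B3′ of the
# road of record for the engine stub PSB_θψ (card `shapiro`, step E1b): THE CONCRETE EIGENLINE behind `ρ̄ ⊗ k' ≅ Coind_U^G χ`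

LEAD `cruxlead-stmt-BirchSwinnertonDyer-23599` g4 (cell `bsd-ssimc`); ROUTE-INDEPENDENT helper (`--supports stmt-BirchSwinnertonDyer-23599`);
pure algebra over the tree's Serre 1972 §2 vocabulary (`Serre1972.unitGroup`, `adjoinElem`, `conj_eq_or_conj_eq_of_mem_normalizer`) and
brick B3 (`exists_equiv_coind_of_index_two`, p754562); THEOREMS ONLY (representations / characters delivered as `∃` with their formulas);
no named fact, no `sorry`; closes nothing; BSD is not proved by any of this.

WHY (census `Lines/rtt_w3-CENSUS-PSB-g3.md` §2 E1; registered text of `stub_psbTheta_ns`, binders `Φ, k, e₀`): brick B3 is abstract — it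
ASSUMES a `U`-eigenvector `v` with eigencharacter `χ`, `g₀ ∉ U` and coordinates `α, β` for the basis `(v, ρ(g₀)v)`. This file PRODUCES
them from the Cartan datum: a matrix representation `r : G →* GL₂(F)` normalising the non-split Cartan subgroup `kˣ` of a quadratic
field `k = F[y₀] ⊂ M₂(F)` without lying in it. Over any `k' ⊇ F` holding a root `lam` of `X² − tr(y₀)X + det(y₀)`,
`v := (y₀ − lam')e` (`lam' = tr(y₀) − lam`, Cayley–Hamilton) is a common eigenvector of `k`, hence of `U = r⁻¹(kˣ)`; an `r g₀ ∈ N(kˣ) ∖ kˣ`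
conjugates `y₀` to `tr(y₀) − y₀` (Serre §2.2), so `ρ(g₀)v` is a `lam'`-eigenvector and `(v, ρ(g₀)v)` is a basis (`lam ≠ lam'` by
separability; Cayley–Hamilton inlined). Main results: `exists_representation_map_mulVec` (scalar extension of `r` as a `Representation k' G (Fin 2 → k')`),
★ `exists_eigenline_data_of_normalizer_unitGroup` (the data `(χ, v, α, β)` with B3's hypotheses and `χ(u) = a + b·lam` for
`r u = a + b y₀`), ★ `exists_equiv_coind_of_normalizer_unitGroup` (∘ B3: `ρ ≃ Coind_U^G χ`), ★ `exists_equiv_coind_of_smallImageDatum`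
(ON THE CRUX'S BINDERS: `U = Γ_K` has index `2`, separability is automatic over `𝔽_p`, and `ρ̄_{W,p} ⊗ k'` framed by `Φ` IS
`Coind_{Γ_K}^{Γ_ℚ} χ` — the input of brick B2 `…RttShapiroMackey`, Shapiro∘Mackey on cohomology).

References: [Serre1972] §2.1 b), §2.2 (normaliser of a non-split Cartan subgroup, the automorphism `x ↦ sxs⁻¹` of `k`); Cayley–Hamilton
for `2 × 2` matrices [folklore]; motivation [Rubin1991] §4, card `Ideas/shapiro.md` (b3).
-/

set_option autoImplicit false
-- D-0017: single-problem summit, the namespace repeats the problem name by design.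
set_option linter.dupNamespace false
noncomputable section

open Representation Matrix
open scoped MatrixGroups
open Literature.NumberTheory.GaloisRepresentations.Serre1972

universe u

namespace Summit.BirchSwinnertonDyer.BirchSwinnertonDyer.Theorems.SmallImageRttShapiro

section Abstract

variable {F : Type u} [Field F] {k' : Type u} [Field k'] [Algebra F k'] {G : Type u} [Group G]

/-- **Scalar extension of a `2`-dimensional matrix representation.** For `r : G →* GL₂(F)` and an `F`-algebra `k'` there is a
`Representation k' G (Fin 2 → k')` acting by the matrices `(r g)^{k'} = (r g).map (algebraMap F k')` on column vectors (delivered as an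
existence statement with its formula, so that no definition is introduced). [folklore] -/
theorem exists_representation_map_mulVec (r : G →* GL (Fin 2) F) :
    ∃ ρ : Representation k' G (Fin 2 → k'),
      ∀ (g : G) (w : Fin 2 → k'),
        ρ g w = ((r g : GL (Fin 2) F) : Matrix (Fin 2) (Fin 2) F).map (algebraMap F k') *ᵥ w := by
  let f : G → Module.End k' (Fin 2 → k') := fun g ↦
    Matrix.toLin' (((r g : GL (Fin 2) F) : Matrix (Fin 2) (Fin 2) F).map (algebraMap F k'))
  have hf1 : f 1 = 1 := by
    simp only [f, map_one, Units.val_one, Matrix.map_one (algebraMap F k') (map_zero _) (map_one _),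
      Matrix.toLin'_one]
    rfl
  have hfmul : ∀ g h : G, f (g * h) = f g * f h := fun g h ↦ by
    simp only [f, map_mul, Units.val_mul]
    rw [Matrix.map_mul, Matrix.toLin'_mul]
    rfl
  refine ⟨{ toFun := f, map_one' := hf1, map_mul' := hfmul }, fun g w ↦ ?_⟩
  show f g w = _
  simp only [f, Matrix.toLin'_apply]

/-- A non-scalar matrix stays non-scalar after an injective extension of scalars (a field map): if `y₀ ≠ c • 1` for all `c ∈ F`
then `y₀^{k'} ≠ c' • 1` for all `c' ∈ k'`. [folklore] -/
theorem map_ne_smul_one_of_ne_smul_one {y₀ : Matrix (Fin 2) (Fin 2) F} (hys : ∀ c : F, y₀ ≠ c • 1) (c' : k') :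
    y₀.map (algebraMap F k') ≠ c' • (1 : Matrix (Fin 2) (Fin 2) k') := by
  intro h
  have h01 : y₀ 0 1 = 0 := by
    have := congr_fun (congr_fun h 0) 1
    simpa [Matrix.map_apply, Matrix.one_apply] using this
  have h10 : y₀ 1 0 = 0 := by
    have := congr_fun (congr_fun h 1) 0
    simpa [Matrix.map_apply, Matrix.one_apply] using this
  have h00 : algebraMap F k' (y₀ 0 0) = c' := by
    have := congr_fun (congr_fun h 0) 0
    simpa [Matrix.map_apply, Matrix.one_apply] using this
  have h11 : algebraMap F k' (y₀ 1 1) = c' := by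
    have := congr_fun (congr_fun h 1) 1
    simpa [Matrix.map_apply, Matrix.one_apply] using this
  have hdiag : y₀ 0 0 = y₀ 1 1 := (algebraMap F k').injective (h00.trans h11.symm)
  apply hys (y₀ 0 0)
  ext i j
  fin_cases i <;> fin_cases j <;> simp [h01, h10, hdiag]

/-- ★ **The concrete eigenline (brick B3′).** Let `k ⊂ M₂(F)` be a subalgebra which is a field of degree `2`, `y₀ ∈ k` non-scalar with
`tr(y₀)² − 4 det(y₀) ≠ 0`, `lam ∈ k'` a root of `X² − tr(y₀)X + det(y₀)`, and `r : G →* GL₂(F)` a representation whose image normalises the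
non-split Cartan subgroup `kˣ = unitGroup k`, with some `r g₀ ∉ kˣ`; let `ρ` be the scalar extension of `r` to `k'` and `U = r⁻¹(kˣ)`. Then
there are an eigencharacter `χ : U →* k'ˣ`, a vector `v ≠ 0` and coordinates `α, β` with: `ρ(u)v = χ(u)v` (`u ∈ U`), `y₀v = lamv`,
`α(w)v + β(w)ρ(g₀)v = w`, `α(v) = 1`, `α(ρ(g₀)v) = 0`, and `χ(u) = a + blam` whenever `r u = a·1 + b·y₀` — the hypotheses of brick B3
(`exists_equiv_coind_of_index_two`). Proof: `v = (y₀ − lam')e` for a standard vector `e` (Cayley–Hamilton), `k = F[y₀]`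
(`adjoinElem_eq_of_mem_of_finrank_eq_two`), and `r g₀` conjugates `y₀` to `tr(y₀) − y₀` (Serre §2.2,
`conj_eq_or_conj_eq_of_mem_normalizer` with `mem_unitGroup_of_conj_eq`), so `ρ(g₀)v` is a `lam'`-eigenvector, independent of `v`.
[cite: Serre1972, §2.2] -/
theorem exists_eigenline_data_of_normalizer_unitGroup {k : Subalgebra F (Matrix (Fin 2) (Fin 2) F)} (hk : IsField k)
    (h2 : Module.finrank F k = 2) {y₀ : Matrix (Fin 2) (Fin 2) F} (hy₀ : y₀ ∈ k) (hys : ∀ c : F, y₀ ≠ c • 1)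
    (hdisc : y₀.trace ^ 2 - 4 * y₀.det ≠ 0) (lam : k')
    (hlam : lam ^ 2 - algebraMap F k' y₀.trace * lam + algebraMap F k' y₀.det = 0)
    (r : G →* GL (Fin 2) F) (hN : ∀ g : G, r g ∈ Subgroup.normalizer (unitGroup k : Set (GL (Fin 2) F)))
    (g₀ : G) (hg₀ : r g₀ ∉ unitGroup k) (ρ : Representation k' G (Fin 2 → k'))
    (hρ : ∀ (g : G) (w : Fin 2 → k'),
      ρ g w = ((r g : GL (Fin 2) F) : Matrix (Fin 2) (Fin 2) F).map (algebraMap F k') *ᵥ w) :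
    ∃ (χ : (unitGroup k).comap r →* k'ˣ) (v : Fin 2 → k') (α β : (Fin 2 → k') →ₗ[k'] k'),
      v ≠ 0 ∧ y₀.map (algebraMap F k') *ᵥ v = lam • v ∧
      (∀ u : (unitGroup k).comap r, ρ (u : G) v = ((χ u : k'ˣ) : k') • v) ∧
      (∀ w : Fin 2 → k', α w • v + β w • ρ g₀ v = w) ∧ α v = 1 ∧ α (ρ g₀ v) = 0 ∧
      (∀ (u : (unitGroup k).comap r) (a b : F),
        ((r (u : G) : GL (Fin 2) F) : Matrix (Fin 2) (Fin 2) F) = a • (1 : Matrix (Fin 2) (Fin 2) F) + b • y₀ →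
          ((χ u : k'ˣ) : k') = algebraMap F k' a + algebraMap F k' b * lam) := by
  classical
  set ι := algebraMap F k' with hι
  set Y : Matrix (Fin 2) (Fin 2) k' := y₀.map ι with hY
  set t : k' := ι y₀.trace with ht
  set d : k' := ι y₀.det with hd
  set mu : k' := t - lam with hmu
  have hYtr : Y.trace = t := by simp [hY, ht, Matrix.trace_fin_two, Matrix.map_apply]
  have hYdet : Y.det = d := by simp [hY, hd, Matrix.det_fin_two, Matrix.map_apply]
  have hCH : Y * Y - t • Y + d • (1 : Matrix (Fin 2) (Fin 2) k') = 0 := by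
    rw [← hYtr, ← hYdet]; ext a b   -- Cayley–Hamilton for `2 × 2` matrices
    fin_cases a <;> fin_cases b <;>
      simp [Matrix.mul_apply, Fin.sum_univ_two, Matrix.trace_fin_two, Matrix.det_fin_two] <;> ring
  have hlm : lam * mu = d := by
    have : lam ^ 2 - t * lam + d = 0 := hlam
    rw [hmu]; linear_combination -this
  have hlm' : lam + mu = t := by rw [hmu]; ring
  have hE1 : Y * (Y - mu • (1 : Matrix (Fin 2) (Fin 2) k')) = lam • (Y - mu • 1) := by
    have h : Y * Y = t • Y - d • (1 : Matrix (Fin 2) (Fin 2) k') := by rw [← sub_eq_zero]; rw [← hCH]; abel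
    rw [mul_sub, h, mul_smul_comm, mul_one, smul_sub, ← hlm', ← hlm, add_smul, smul_smul]
    abel
  have hne : lam ≠ mu := by
    intro h
    have h1 : (lam - mu) ^ 2 = t ^ 2 - 4 * d := by rw [← hlm', ← hlm]; ring
    have h2' : ι (y₀.trace ^ 2 - 4 * y₀.det) = 0 := by
      simp only [map_sub, map_mul, map_pow, map_ofNat]; rw [← ht, ← hd, ← h1, h, sub_self]; ring
    exact hdisc ((map_eq_zero_iff ι ι.injective).mp h2')
  have hYmu : Y - mu • (1 : Matrix (Fin 2) (Fin 2) k') ≠ 0 := fun h ↦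
    map_ne_smul_one_of_ne_smul_one hys mu (sub_eq_zero.mp h)
  obtain ⟨i, hi⟩ : ∃ i : Fin 2, (Y - mu • (1 : Matrix (Fin 2) (Fin 2) k')) *ᵥ Pi.single i 1 ≠ 0 := by
    by_contra h
    push Not at h
    exact hYmu (by ext a b; simpa [Matrix.mulVec_single_one] using congr_fun (h b) a)
  set v : Fin 2 → k' := (Y - mu • (1 : Matrix (Fin 2) (Fin 2) k')) *ᵥ Pi.single i 1 with hv
  have hv0 : v ≠ 0 := hi
  have hYv : Y *ᵥ v = lam • v := by rw [hv, Matrix.mulVec_mulVec, hE1, Matrix.smul_mulVec]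
  have hk' : adjoinElem y₀ = k := adjoinElem_eq_of_mem_of_finrank_eq_two h2 hy₀ hys
  have hmap1 : ∀ a b : F, (a • (1 : Matrix (Fin 2) (Fin 2) F) + b • y₀).map ι =
      ι a • (1 : Matrix (Fin 2) (Fin 2) k') + ι b • Y := fun a b ↦ by
    ext a' b'
    simp only [hY, Matrix.map_apply, Matrix.add_apply, Matrix.smul_apply, Matrix.one_apply, smul_eq_mul, map_add, map_mul]
    split_ifs <;> simp
  have hUscalar : ∀ (u : (unitGroup k).comap r) (a b : F),
      ((r (u : G) : GL (Fin 2) F) : Matrix (Fin 2) (Fin 2) F) = a • (1 : Matrix (Fin 2) (Fin 2) F) + b • y₀ →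
        ρ (u : G) v = (ι a + ι b * lam) • v := by
    intro u a b hab
    rw [hρ, hab, hmap1, Matrix.add_mulVec, Matrix.smul_mulVec, Matrix.smul_mulVec, Matrix.one_mulVec, hYv,
      smul_smul, ← add_smul]
  have hUdec : ∀ u : (unitGroup k).comap r, ∃ a b : F,
      ((r (u : G) : GL (Fin 2) F) : Matrix (Fin 2) (Fin 2) F) = a • (1 : Matrix (Fin 2) (Fin 2) F) + b • y₀ := by
    intro u
    exact mem_adjoinElem_iff.mp (by rw [hk']; exact u.2)
  set M₀ : Matrix (Fin 2) (Fin 2) F := ((r g₀ : GL (Fin 2) F) : Matrix (Fin 2) (Fin 2) F) with hM₀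
  have hconj : M₀ * y₀ * M₀⁻¹ = y₀.trace • (1 : Matrix (Fin 2) (Fin 2) F) - y₀ := by
    exact (conj_eq_or_conj_eq_of_mem_normalizer hk hy₀ hys (hN g₀)).resolve_left
      fun h ↦ hg₀ (mem_unitGroup_of_conj_eq hy₀ hys h)
  have hM₀det : IsUnit M₀.det := by rw [hM₀, ← Matrix.GeneralLinearGroup.val_det_apply]; exact Units.isUnit _
  have hcomm : y₀ * M₀ = M₀ * (y₀.trace • (1 : Matrix (Fin 2) (Fin 2) F) - y₀) := by
    have h1 : M₀ * y₀ = (y₀.trace • (1 : Matrix (Fin 2) (Fin 2) F) - y₀) * M₀ := by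
      calc M₀ * y₀ = M₀ * y₀ * M₀⁻¹ * M₀ := by rw [Matrix.nonsing_inv_mul_cancel_right _ _ hM₀det]
        _ = _ := by rw [hconj]
    rw [mul_sub, mul_smul_comm, mul_one, h1, sub_mul, smul_mul_assoc, one_mul]; abel
  set N₀ : Matrix (Fin 2) (Fin 2) k' := M₀.map ι with hN₀
  have hmap2 : (y₀.trace • (1 : Matrix (Fin 2) (Fin 2) F) - y₀).map ι = t • (1 : Matrix (Fin 2) (Fin 2) k') - Y := by
    ext a' b'
    simp only [hY, ht, Matrix.map_apply, Matrix.sub_apply, Matrix.smul_apply, Matrix.one_apply, smul_eq_mul, map_sub, map_mul]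
    split_ifs <;> simp
  have hcomm' : Y * N₀ = N₀ * (t • (1 : Matrix (Fin 2) (Fin 2) k') - Y) := by
    have := congr_arg (fun M : Matrix (Fin 2) (Fin 2) F ↦ M.map ι) hcomm
    simp only [Matrix.map_mul] at this; rwa [hmap2] at this
  set w₀ : Fin 2 → k' := ρ g₀ v with hw₀
  have hw₀' : w₀ = N₀ *ᵥ v := by rw [hw₀, hρ]
  have hYw : Y *ᵥ w₀ = mu • w₀ := by
    rw [hw₀', Matrix.mulVec_mulVec, hcomm', ← Matrix.mulVec_mulVec, Matrix.sub_mulVec, Matrix.smul_mulVec,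
      Matrix.one_mulVec, hYv, ← sub_smul, Matrix.mulVec_smul]
  have hN₀det : IsUnit N₀.det := by rw [hN₀, ← RingHom.mapMatrix_apply, ← RingHom.map_det]; exact hM₀det.map _
  have hw0 : w₀ ≠ 0 := fun h ↦ hv0 <| by
    rw [← show N₀⁻¹ *ᵥ (N₀ *ᵥ v) = v by rw [Matrix.mulVec_mulVec, Matrix.nonsing_inv_mul _ hN₀det, Matrix.one_mulVec],
      ← hw₀', h, Matrix.mulVec_zero]
  have key : ∀ c c' : k', c • v = c' • w₀ → c = 0 := by
    intro c c' hcc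
    have h1 : Y *ᵥ (c • v) = (c * lam) • v := by rw [Matrix.mulVec_smul, hYv, smul_smul]
    have h2' : Y *ᵥ (c' • w₀) = (mu * c) • v := by
      rw [Matrix.mulVec_smul, hYw, smul_smul, mul_comm c' mu, ← smul_smul, ← hcc, smul_smul]
    have h3 : (c * lam) • v = (mu * c) • v := by rw [← h1, hcc, h2']
    have h4 : (c * lam - mu * c) • v = 0 := by rw [sub_smul, h3, sub_self]
    rcases smul_eq_zero.mp h4 with h5 | h5
    · exact (mul_eq_zero.mp (by linear_combination h5 : c * (lam - mu) = 0)).resolve_right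
        fun h7 ↦ hne (sub_eq_zero.mp h7)
    · exact absurd h5 hv0
  have hD0 : v 0 * w₀ 1 - v 1 * w₀ 0 ≠ 0 := by
    intro hD0
    have hz1 : w₀ 1 • v = v 1 • w₀ := by
      ext j; fin_cases j
      · simp only [Pi.smul_apply, smul_eq_mul, Fin.zero_eta, Fin.isValue]; linear_combination hD0
      · simp only [Pi.smul_apply, smul_eq_mul, Fin.mk_one, Fin.isValue]; ring
    have hz0 : w₀ 0 • v = v 0 • w₀ := by
      ext j; fin_cases j
      · simp only [Pi.smul_apply, smul_eq_mul, Fin.zero_eta, Fin.isValue]; ring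
      · simp only [Pi.smul_apply, smul_eq_mul, Fin.mk_one, Fin.isValue]; linear_combination -hD0
    apply hw0
    ext j; fin_cases j
    · exact key _ _ hz0
    · exact key _ _ hz1
  let α : (Fin 2 → k') →ₗ[k'] k' :=
    { toFun := fun x ↦ (x 0 * w₀ 1 - x 1 * w₀ 0) * (v 0 * w₀ 1 - v 1 * w₀ 0)⁻¹
      map_add' := fun x x' ↦ by simp only [Pi.add_apply]; ring
      map_smul' := fun c x ↦ by simp only [Pi.smul_apply, smul_eq_mul, RingHom.id_apply]; ring }
  let β : (Fin 2 → k') →ₗ[k'] k' :=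
    { toFun := fun x ↦ (v 0 * x 1 - v 1 * x 0) * (v 0 * w₀ 1 - v 1 * w₀ 0)⁻¹
      map_add' := fun x x' ↦ by simp only [Pi.add_apply]; ring
      map_smul' := fun c x ↦ by simp only [Pi.smul_apply, smul_eq_mul, RingHom.id_apply]; ring }
  have hαx : ∀ x, α x = (x 0 * w₀ 1 - x 1 * w₀ 0) * (v 0 * w₀ 1 - v 1 * w₀ 0)⁻¹ := fun x ↦ rfl
  have hβx : ∀ x, β x = (v 0 * x 1 - v 1 * x 0) * (v 0 * w₀ 1 - v 1 * w₀ 0)⁻¹ := fun x ↦ rfl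
  have hαv : α v = 1 := by rw [hαx]; exact mul_inv_cancel₀ hD0
  have hαw : α w₀ = 0 := by rw [hαx]; ring
  have hdec : ∀ x : Fin 2 → k', α x • v + β x • w₀ = x := by
    intro x
    have hcoord : ∀ j : Fin 2, (x 0 * w₀ 1 - x 1 * w₀ 0) * v j + (v 0 * x 1 - v 1 * x 0) * w₀ j =
        x j * (v 0 * w₀ 1 - v 1 * w₀ 0) := by
      intro j; fin_cases j
      · simp only [Fin.zero_eta, Fin.isValue]; ring
      · simp only [Fin.mk_one, Fin.isValue]; ring
    ext j
    simp only [Pi.add_apply, Pi.smul_apply, smul_eq_mul, hαx, hβx]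
    calc (x 0 * w₀ 1 - x 1 * w₀ 0) * (v 0 * w₀ 1 - v 1 * w₀ 0)⁻¹ * v j +
          (v 0 * x 1 - v 1 * x 0) * (v 0 * w₀ 1 - v 1 * w₀ 0)⁻¹ * w₀ j
        = ((x 0 * w₀ 1 - x 1 * w₀ 0) * v j + (v 0 * x 1 - v 1 * x 0) * w₀ j) *
            (v 0 * w₀ 1 - v 1 * w₀ 0)⁻¹ := by ring
      _ = x j * (v 0 * w₀ 1 - v 1 * w₀ 0) * (v 0 * w₀ 1 - v 1 * w₀ 0)⁻¹ := by rw [hcoord j]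
      _ = x j := by rw [mul_assoc, mul_inv_cancel₀ hD0, mul_one]
  let ev : G → k' := fun g ↦ α (ρ g v)
  have hev : ∀ u : (unitGroup k).comap r, ρ (u : G) v = ev (u : G) • v := by
    intro u
    obtain ⟨a, b, hab⟩ := hUdec u
    have h := hUscalar u a b hab
    have : ev (u : G) = ι a + ι b * lam := by show α (ρ (u : G) v) = _; rw [h, map_smul, hαv, smul_eq_mul, mul_one]
    rw [this, h]
  have hev1 : ev 1 = 1 := by show α (ρ 1 v) = 1; rw [map_one]; exact hαv
  have hevmul : ∀ u u' : (unitGroup k).comap r, ev ((u : G) * (u' : G)) = ev (u : G) * ev (u' : G) := by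
    intro u u'
    have step : ρ ((u : G) * (u' : G)) v = (ev (u' : G) * ev (u : G)) • v := by
      rw [map_mul, Module.End.mul_apply, hev u', map_smul, hev u, smul_smul]
    show α (ρ ((u : G) * (u' : G)) v) = ev (u : G) * ev (u' : G)
    rw [step, map_smul, hαv, smul_eq_mul, mul_one, mul_comm]
  let χ₀ : (unitGroup k).comap r →* k' :=
    { toFun := fun u ↦ ev (u : G)
      map_one' := hev1
      map_mul' := fun u u' ↦ hevmul u u' }
  let χ : (unitGroup k).comap r →* k'ˣ := χ₀.toHomUnits
  have hχ : ∀ u : (unitGroup k).comap r, ((χ u : k'ˣ) : k') = ev (u : G) := fun u ↦ rfl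
  refine ⟨χ, v, α, β, hv0, hYv, fun u ↦ by rw [hχ, hev], fun w ↦ hdec w, hαv, hαw, fun u a b hab ↦ ?_⟩
  rw [hχ]
  show α (ρ (u : G) v) = _
  rw [hUscalar u a b hab, map_smul, hαv, smul_eq_mul, mul_one]

/-- ★ **Brick B3′ ∘ B3: the representation IS the coinduced one.** In the setting of `exists_eigenline_data_of_normalizer_unitGroup`,
if moreover `U = r⁻¹(kˣ)` has index `2` in `G`, then `ρ ⊗ k' ≅ Coind_U^G χ` for the eigencharacter `χ` (an explicit
`Representation.Equiv`, the Frobenius-reciprocity intertwiner `w ↦ (x ↦ α(ρ(x)w))` of brick B3 `exists_equiv_coind_of_index_two`), and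
`χ(u) = a + blam` whenever `r u = a·1 + b·y₀`. [cite: Serre1972, §2.2] -/
theorem exists_equiv_coind_of_normalizer_unitGroup {k : Subalgebra F (Matrix (Fin 2) (Fin 2) F)} (hk : IsField k)
    (h2 : Module.finrank F k = 2) {y₀ : Matrix (Fin 2) (Fin 2) F} (hy₀ : y₀ ∈ k) (hys : ∀ c : F, y₀ ≠ c • 1)
    (hdisc : y₀.trace ^ 2 - 4 * y₀.det ≠ 0) (lam : k')
    (hlam : lam ^ 2 - algebraMap F k' y₀.trace * lam + algebraMap F k' y₀.det = 0)
    (r : G →* GL (Fin 2) F) (hN : ∀ g : G, r g ∈ Subgroup.normalizer (unitGroup k : Set (GL (Fin 2) F)))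
    (hU : ((unitGroup k).comap r).index = 2) (g₀ : G) (hg₀ : r g₀ ∉ unitGroup k)
    (ρ : Representation k' G (Fin 2 → k'))
    (hρ : ∀ (g : G) (w : Fin 2 → k'),
      ρ g w = ((r g : GL (Fin 2) F) : Matrix (Fin 2) (Fin 2) F).map (algebraMap F k') *ᵥ w) :
    ∃ (χ : (unitGroup k).comap r →* k'ˣ) (v : Fin 2 → k') (α : (Fin 2 → k') →ₗ[k'] k'),
      v ≠ 0 ∧ (∀ u : (unitGroup k).comap r, ρ (u : G) v = ((χ u : k'ˣ) : k') • v) ∧ α v = 1 ∧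
      (∀ (u : (unitGroup k).comap r) (a b : F),
        ((r (u : G) : GL (Fin 2) F) : Matrix (Fin 2) (Fin 2) F) = a • (1 : Matrix (Fin 2) (Fin 2) F) + b • y₀ →
          ((χ u : k'ˣ) : k') = algebraMap F k' a + algebraMap F k' b * lam) ∧
      ∃ e : Representation.Equiv ρ
          (coind ((unitGroup k).comap r).subtype ((DistribMulAction.toModuleEnd k' k').comp ((Units.coeHom k').comp χ))),
        ∀ (w : Fin 2 → k') (x : G), (e.toLinearEquiv w).1 x = α (ρ x w) := by
  obtain ⟨χ, v, α, β, hv0, -, hv, hdec, hαv, hαg, hχ⟩ :=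
    exists_eigenline_data_of_normalizer_unitGroup hk h2 hy₀ hys hdisc lam hlam r hN g₀ hg₀ ρ hρ
  have hg₀U : g₀ ∉ (unitGroup k).comap r := hg₀
  obtain ⟨e, he⟩ := exists_equiv_coind_of_index_two ((unitGroup k).comap r) ρ hU g₀ hg₀U χ v hv α β hdec hαv hαg
  exact ⟨χ, v, α, hv0, hv, hαv, hχ, e, he⟩

end Abstract

section SmallImage

open WeierstrassCurve Field Literature.NumberTheory.GaloisRepresentations

/-- A subalgebra `k ⊆ M₂(F)` of degree `2` contains a non-scalar element (otherwise `k = F·1 = ⊥` has degree `1`). [folklore] -/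
theorem exists_mem_ne_smul_one_of_finrank_eq_two {F : Type u} [Field F] {k : Subalgebra F (Matrix (Fin 2) (Fin 2) F)}
    (h2 : Module.finrank F k = 2) : ∃ y₀ ∈ k, ∀ c : F, y₀ ≠ c • (1 : Matrix (Fin 2) (Fin 2) F) := by
  by_contra h
  push Not at h
  have hbot : k = ⊥ := by
    refine le_antisymm (fun y hy ↦ ?_) bot_le
    obtain ⟨c, hc⟩ := h y hy
    rw [hc, ← Algebra.algebraMap_eq_smul_one]
    exact Subalgebra.algebraMap_mem ⊥ c
  have h1 : Module.finrank F k = 1 := by rw [hbot]; exact Subalgebra.finrank_bot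
  omega

variable {p : ℕ} [Fact p.Prime]

/-- ★ **B3′ on the crux's binders: `ρ̄_{W,p} ⊗ k' ≅ Coind_{Γ_K}^{Γ_ℚ} χ`.** Let `W/ℚ` be a Weierstrass curve, `K` a quadratic number field,
`Φ : Aut(W[p]) ≃ GL₂(𝔽_p)` a frame and `k ⊂ M₂(𝔽_p)` a subalgebra which is a field of degree `2` such that — EXACTLY the clauses of the
small-image datum in the registered text of `stub_psbTheta_ns` — the image of `ρ̄_{W,p}` normalises `kˣ`, `U := ρ̄⁻¹(Φ⁻¹(kˣ)) ≤ Γ_K` and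
`ρ̄(Γ_K) ⊆ kˣ`. Then for every field `k' ⊇ 𝔽_p` containing a root `lam` of `X² − tr(y₀)X + det(y₀)` (`y₀ ∈ k` non-scalar): `U` has index
`2`, there is `g₀ ∉ U`, and the scalar extension `ρ` of `Φ ∘ ρ̄_{W,p}` to `k'` (acting by the matrices `Φ(ρ̄(σ))^{k'}`) has a `U`-eigenvector
`v ≠ 0` with eigencharacter `χ : U →* k'ˣ` (`χ(u) = a + b·lam` for `Φ(ρ̄(u)) = a + b y₀`) and an explicit equivalence
`ρ ≃ Coind_U^{Γ_ℚ} χ`, `(e w)(x) = α(ρ(x)w)` with `α(v) = 1` — the representation-theoretic input of the Shapiro step E1 of the road of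
record (`Hⁿ(ℚ, ρ̄ ⊗ k') ≅ Hⁿ(K, ψ̄)`, brick B2). [cite: Serre1972, §2.2] -/
theorem exists_equiv_coind_of_smallImageDatum (W : WeierstrassCurve ℚ) (K : Type) [Field K] [NumberField K]
    (hK2 : Module.finrank ℚ K = 2)
    (Φ : Multiplicative (AddAut (geomTorsion W p)) ≃* GL (Fin 2) (ZMod p))
    (k : Subalgebra (ZMod p) (Matrix (Fin 2) (Fin 2) (ZMod p))) (hk : IsField k) (hk2 : Module.finrank (ZMod p) k = 2)
    (hN : (galoisRepTorsion W p).range.map Φ.toMonoidHom ≤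
      Subgroup.normalizer (unitGroup k : Set (GL (Fin 2) (ZMod p))))
    (hU : ((unitGroup k).comap Φ.toMonoidHom).comap (galoisRepTorsion W p) ≤ (absGaloisRestrict ℚ K).toMonoidHom.range)
    (hKU : ∀ τ : absoluteGaloisGroup K, Φ (galoisRepTorsion W p (absGaloisRestrict ℚ K τ)) ∈ unitGroup k)
    {y₀ : Matrix (Fin 2) (Fin 2) (ZMod p)} (hy₀ : y₀ ∈ k) (hys : ∀ c : ZMod p, y₀ ≠ c • 1)
    (k' : Type) [Field k'] [Algebra (ZMod p) k'] (lam : k')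
    (hlam : lam ^ 2 - algebraMap (ZMod p) k' y₀.trace * lam + algebraMap (ZMod p) k' y₀.det = 0) :
    (((unitGroup k).comap Φ.toMonoidHom).comap (galoisRepTorsion W p)).index = 2 ∧
    ∃ (ρ : Representation k' (absoluteGaloisGroup ℚ) (Fin 2 → k')) (g₀ : absoluteGaloisGroup ℚ)
      (χ : (unitGroup k).comap (Φ.toMonoidHom.comp (galoisRepTorsion W p)) →* k'ˣ) (v : Fin 2 → k')
      (α : (Fin 2 → k') →ₗ[k'] k'),
      (∀ (g : absoluteGaloisGroup ℚ) (w : Fin 2 → k'),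
        ρ g w = ((Φ (galoisRepTorsion W p g) : GL (Fin 2) (ZMod p)) : Matrix (Fin 2) (Fin 2) (ZMod p)).map
          (algebraMap (ZMod p) k') *ᵥ w) ∧
      Φ (galoisRepTorsion W p g₀) ∉ unitGroup k ∧ v ≠ 0 ∧
      (∀ u : (unitGroup k).comap (Φ.toMonoidHom.comp (galoisRepTorsion W p)),
        ρ (u : absoluteGaloisGroup ℚ) v = ((χ u : k'ˣ) : k') • v) ∧ α v = 1 ∧
      (∀ (u : (unitGroup k).comap (Φ.toMonoidHom.comp (galoisRepTorsion W p))) (a b : ZMod p),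
        ((Φ (galoisRepTorsion W p (u : absoluteGaloisGroup ℚ)) : GL (Fin 2) (ZMod p)) :
            Matrix (Fin 2) (Fin 2) (ZMod p)) = a • (1 : Matrix (Fin 2) (Fin 2) (ZMod p)) + b • y₀ →
          ((χ u : k'ˣ) : k') = algebraMap (ZMod p) k' a + algebraMap (ZMod p) k' b * lam) ∧
      ∃ e : Representation.Equiv ρ
          (coind ((unitGroup k).comap (Φ.toMonoidHom.comp (galoisRepTorsion W p))).subtype
            ((DistribMulAction.toModuleEnd k' k').comp ((Units.coeHom k').comp χ))),
        ∀ (w : Fin 2 → k') (x : absoluteGaloisGroup ℚ), (e.toLinearEquiv w).1 x = α (ρ x w) := by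
  set r : absoluteGaloisGroup ℚ →* GL (Fin 2) (ZMod p) := Φ.toMonoidHom.comp (galoisRepTorsion W p) with hr
  have hrg : ∀ g, r g = Φ (galoisRepTorsion W p g) := fun g ↦ rfl
  have hUU : ((unitGroup k).comap Φ.toMonoidHom).comap (galoisRepTorsion W p) = (unitGroup k).comap r := by
    rw [hr, Subgroup.comap_comap]
  haveI : FiniteDimensional ℚ K := Module.finite_of_finrank_eq_succ hK2
  have hUeq : (unitGroup k).comap r = (absGaloisRestrict ℚ K).toMonoidHom.range := by
    refine le_antisymm (fun g hg ↦ hU (by rw [hUU]; exact hg)) ?_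
    rintro g ⟨τ, rfl⟩
    exact hKU τ
  have hidx : ((unitGroup k).comap r).index = 2 := by
    rw [hUeq]
    exact (index_range_absGaloisRestrict_eq_finrank ℚ K).trans hK2
  refine ⟨by rw [hUU]; exact hidx, ?_⟩
  obtain ⟨g₀, hg₀⟩ : ∃ g₀ : absoluteGaloisGroup ℚ, g₀ ∉ (unitGroup k).comap r := by
    by_contra h
    push Not at h
    have htop : (unitGroup k).comap r = ⊤ := by ext g; exact ⟨fun _ ↦ trivial, fun _ ↦ h g⟩
    rw [htop, Subgroup.index_top] at hidx
    exact absurd hidx (by norm_num)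
  have hg₀' : r g₀ ∉ unitGroup k := hg₀
  have hN' : ∀ g : absoluteGaloisGroup ℚ, r g ∈ Subgroup.normalizer (unitGroup k : Set (GL (Fin 2) (ZMod p))) :=
    fun g ↦ hN ⟨galoisRepTorsion W p g, ⟨g, rfl⟩, rfl⟩
  have hdisc : y₀.trace ^ 2 - 4 * y₀.det ≠ 0 := trace_sq_sub_four_det_ne_zero_of_isField hk hy₀ hys
  obtain ⟨ρ, hρ⟩ := exists_representation_map_mulVec (k' := k') r
  obtain ⟨χ, v, α, hv0, hv, hαv, hχ, e, he⟩ :=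
    exists_equiv_coind_of_normalizer_unitGroup hk hk2 hy₀ hys hdisc lam hlam r hN' hidx g₀ hg₀' ρ hρ
  exact ⟨ρ, g₀, χ, v, α, fun g w ↦ hρ g w, hg₀', hv0, hv, hαv, hχ, e, he⟩

end SmallImage

end Summit.BirchSwinnertonDyer.BirchSwinnertonDyer.Theorems.SmallImageRttShapiro

end
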